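import Summits.CriticalPhenomena.Ising3D.TaylorQPolyParity
import Summits.CriticalPhenomena.Ising3D.TaylorRegionQPoly
import Mathlib.Algebra.QuadraticDiscriminant
import Mathlib.Tactic.Linarith
import Mathlib.Tactic.Positivity
import Mathlib.Tactic.Ring
import HarnessLib

/-!
# The even-sector region of a derivative certificate from a TWO-VARIABLE POLYNOMIAL kernel condition
(cell `pub-ising3x`, seat boot-1; gate (g2): the tail region without Legendre-polynomial asymptotics)

HONEST FRAMING: lottery ticket; floor = tightest certified 3D Ising CFT bounds; no exact-solution
claim without a proof.

By `qFactor₂_eq`, each weighted q-sum at `(½,½)` is a `λ`-average over the antidiagonal: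
`qSum c S s σ E j = Σ_{p₁+p₂=j} λ_{p₁} λ_{p₂} · K_c(u, v)`, `u = (E-j)/2 + p₁`, `v = (E-j)/2 + p₂` (so `u, v ≥ 0`,
`u + v = E`), with the KERNEL `K_c(u,v) = Σ_{(a,b)∈S} c(a,b) 2^{a+b} (1 + σ(-1)^{a+b}) q¹(s,u;a) q¹(s,v;b)`
(`evenKernel`; a polynomial of degree `≤ Λ` in each of `u, v`, coefficients polynomial in `s`)
(`qSum_eq_sum_evenKernel`). Since non-negative combinations of PSD `2×2` forms are PSD
(`det_of_sum_psd`), the cone condition `X̂, Ŷ ≥ 0, Ẑ² ≤ 4X̂Ŷ` of `taylorEvenRegion_half_of_qRegion` FOLLOWS from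
the kernel condition on the half-plane region `{u, v ≥ 0, u + v ≥ E₀}`:
`K_X(u,v) ≥ 0, K_Y(u,v) ≥ 0, K_Z(u,v)² ≤ 4 K_X K_Y` (`taylorEvenRegion_half_of_kernelRegion`) — a polynomial
matrix inequality in two real variables, decidable box by box with an asymptotic argument, with NO appeal to
the Legendre structure of `𝒫_j` (the `(E, J)`-polynomial form of the float probe is not needed in Lean).
It is only SUFFICIENT (the λ-average could be PSD without each kernel value being so). Elementary.
-/

namespace Summit.CriticalPhenomena.Ising3D

open Finset
open Literature.MathematicalPhysics.QuantumFieldTheory.ConformalBootstrap3D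

/-- The two-variable kernel of a component: `Σ_{(a,b)∈S} c(a,b) 2^{a+b} (1 + σ(-1)^{a+b}) q¹(s,u;a) q¹(s,v;b)`.
[folklore] -/
noncomputable def evenKernel (c : ℕ × ℕ → ℝ) (S : Finset (ℕ × ℕ)) (s σ u v : ℝ) : ℝ :=
  ∑ ab ∈ S, c ab * 2 ^ (ab.1 + ab.2) * (1 + σ * (-1) ^ (ab.1 + ab.2)) *
    (qFactor₁ s u ab.1 * qFactor₁ s v ab.2)

/-- **The q-sum is a `λ`-average of kernel values on the antidiagonal.** [folklore] -/
theorem qSum_eq_sum_evenKernel (c : ℕ × ℕ → ℝ) (S : Finset (ℕ × ℕ)) (s σ E : ℝ) (j : ℕ) :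
    qSum c S s σ E j = ∑ p ∈ antidiagonal j, legendreLam p.1 * legendreLam p.2 *
      evenKernel c S s σ ((E - (j : ℝ)) / 2 + p.1) ((E - (j : ℝ)) / 2 + p.2) := by
  unfold qSum evenKernel
  simp_rw [Finset.mul_sum]
  rw [Finset.sum_comm]
  refine Finset.sum_congr rfl fun p _ => Finset.sum_congr rfl fun ab _ => ?_
  rw [qFactor₂_eq, qFactor₂_eq, pow_add]
  ring

/-- **Non-negative combinations of PSD `2×2` forms are PSD** (det form): `μ_p ≥ 0`, `x_p, y_p ≥ 0`,
`z_p² ≤ 4 x_p y_p` ⇒ `Σμx ≥ 0`, `Σμy ≥ 0`, `(Σμz)² ≤ 4 (Σμx)(Σμy)`. [folklore] -/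
theorem det_of_sum_psd {ι : Type*} (T : Finset ι) (μ x y z : ι → ℝ) (hμ : ∀ i ∈ T, 0 ≤ μ i)
    (hx : ∀ i ∈ T, 0 ≤ x i) (hy : ∀ i ∈ T, 0 ≤ y i) (hz : ∀ i ∈ T, z i ^ 2 ≤ 4 * x i * y i) :
    0 ≤ ∑ i ∈ T, μ i * x i ∧ 0 ≤ ∑ i ∈ T, μ i * y i ∧
      (∑ i ∈ T, μ i * z i) ^ 2 ≤ 4 * (∑ i ∈ T, μ i * x i) * (∑ i ∈ T, μ i * y i) := by
  have hX : 0 ≤ ∑ i ∈ T, μ i * x i := Finset.sum_nonneg fun i hi => mul_nonneg (hμ i hi) (hx i hi)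
  have hY : 0 ≤ ∑ i ∈ T, μ i * y i := Finset.sum_nonneg fun i hi => mul_nonneg (hμ i hi) (hy i hi)
  refine ⟨hX, hY, ?_⟩
  -- the summed quadratic form is non-negative for every (a, 1)
  have hform : ∀ t : ℝ, 0 ≤ (∑ i ∈ T, μ i * x i) * (t * t) + (∑ i ∈ T, μ i * z i) * t +
      ∑ i ∈ T, μ i * y i := by
    intro t
    have : (∑ i ∈ T, μ i * x i) * (t * t) + (∑ i ∈ T, μ i * z i) * t + ∑ i ∈ T, μ i * y i =
        ∑ i ∈ T, μ i * (x i * (t * t) + z i * t + y i) := by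
      rw [Finset.sum_mul, Finset.sum_mul, ← Finset.sum_add_distrib, ← Finset.sum_add_distrib]
      exact Finset.sum_congr rfl fun i _ => by ring
    rw [this]
    refine Finset.sum_nonneg fun i hi => mul_nonneg (hμ i hi) ?_
    have := quadForm_nonneg_of_det (hx i hi) (hy i hi) (hz i hi) t 1
    nlinarith [this]
  have hd := discrim_le_zero hform
  rw [discrim] at hd
  nlinarith [hd]

/-- **The kernel condition implies the even region** for `α = taylorCrossing ½ ½ S w`: if for every
`(Δσ,Δε) ∈ Q` and all reals `u, v ≥ 0` with `u + v ≥ E₀` the kernels satisfy `K_X ≥ 0`, `K_Y ≥ 0`,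
`K_Z² ≤ 4 K_X K_Y` (`K_X = evenKernel (w 0) S Δσ (-1)`, `K_Y = evenKernel (w 1) S Δε (-1)`,
`K_Z = evenKernel (w 3) S s̄ (-1) + evenKernel (w 4) S s̄ 1`, `s̄ = (Δσ+Δε)/2`), then
`TaylorEvenRegion (taylorCrossing ½ ½ S w) Q E₀`. [cite: KosPolandSimmonsduffin2014, §3.3 eq. (3.16)] -/
theorem taylorEvenRegion_half_of_kernelRegion (S : Finset (ℕ × ℕ)) (w : Fin 5 → ℕ × ℕ → ℝ)
    (Q : Set (ℝ × ℝ)) (E₀ : ℝ)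
    (hK : ∀ p ∈ Q, ∀ u v : ℝ, 0 ≤ u → 0 ≤ v → E₀ ≤ u + v →
      0 ≤ evenKernel (w 0) S p.1 (-1) u v ∧ 0 ≤ evenKernel (w 1) S p.2 (-1) u v ∧
        (evenKernel (w 3) S ((p.1 + p.2) / 2) (-1) u v + evenKernel (w 4) S ((p.1 + p.2) / 2) 1 u v) ^ 2 ≤
          4 * evenKernel (w 0) S p.1 (-1) u v * evenKernel (w 1) S p.2 (-1) u v) :
    TaylorEvenRegion (taylorCrossing (1 / 2) (1 / 2) S w) Q E₀ := by
  refine taylorEvenRegion_half_of_qRegion S w Q E₀ fun p hp E j hE hj => ?_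
  rw [qSum_eq_sum_evenKernel, qSum_eq_sum_evenKernel, qSum_eq_sum_evenKernel, qSum_eq_sum_evenKernel,
    ← Finset.sum_add_distrib]
  have hz : ∀ q ∈ antidiagonal j,
      legendreLam q.1 * legendreLam q.2 * evenKernel (w 3) S ((p.1 + p.2) / 2) (-1)
          ((E - (j : ℝ)) / 2 + q.1) ((E - (j : ℝ)) / 2 + q.2) +
        legendreLam q.1 * legendreLam q.2 * evenKernel (w 4) S ((p.1 + p.2) / 2) 1
          ((E - (j : ℝ)) / 2 + q.1) ((E - (j : ℝ)) / 2 + q.2) =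
      legendreLam q.1 * legendreLam q.2 * (evenKernel (w 3) S ((p.1 + p.2) / 2) (-1)
          ((E - (j : ℝ)) / 2 + q.1) ((E - (j : ℝ)) / 2 + q.2) + evenKernel (w 4) S ((p.1 + p.2) / 2) 1
          ((E - (j : ℝ)) / 2 + q.1) ((E - (j : ℝ)) / 2 + q.2)) := fun q _ => by ring
  rw [Finset.sum_congr rfl hz]
  have hpt : ∀ q ∈ antidiagonal j, 0 ≤ (E - (j : ℝ)) / 2 + q.1 ∧ 0 ≤ (E - (j : ℝ)) / 2 + q.2 ∧
      E₀ ≤ (E - (j : ℝ)) / 2 + q.1 + ((E - (j : ℝ)) / 2 + q.2) := by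
    intro q hq
    have hq' : (q.1 : ℝ) + q.2 = j := by exact_mod_cast mem_antidiagonal.mp hq
    have h1 : (0 : ℝ) ≤ (E - (j : ℝ)) / 2 := by linarith
    exact ⟨add_nonneg h1 (Nat.cast_nonneg _), add_nonneg h1 (Nat.cast_nonneg _), by linarith⟩
  exact det_of_sum_psd (antidiagonal j) (fun q => legendreLam q.1 * legendreLam q.2) _ _ _
    (fun q _ => mul_nonneg (legendreLam_pos _).le (legendreLam_pos _).le)
    (fun q hq => (hK p hp _ _ (hpt q hq).1 (hpt q hq).2.1 (hpt q hq).2.2).1)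
    (fun q hq => (hK p hp _ _ (hpt q hq).1 (hpt q hq).2.1 (hpt q hq).2.2).2.1)
    (fun q hq => (hK p hp _ _ (hpt q hq).1 (hpt q hq).2.1 (hpt q hq).2.2).2.2)

end Summit.CriticalPhenomena.Ising3D
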